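import Summits.FinalStateConjecture.FinalStateConjecture.Theorems.EIHFluxBalanceInertialRecessionRechartCarterRaise
import Summits.FinalStateConjecture.FinalStateConjecture.Theorems.EIHFluxBalanceInertialRecessionRechartCarterCertify

/-!
# Route EIHFluxBalance — `InertialRecession`, re-charting: CERTIFIED CARTER REACH OF A CLOCK CHART
# from the clock-chart package data (the `hstat` of the transfer, rotating holes, all in one)

Helper file for the crux `stmt-FinalStateConjecture-10166`
(`Summit.FinalStateConjecture.FinalStateConjecture.Theses.EIHFluxBalance.InertialRecession`),
stub `stub_rechart` (the transfer P2 of line `sublinear-is-free-clean-window-charges`).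

* `exists_monotone_convergence_profile` — from "`truncDeviationCk … R τ → 0` for every fixed `R`"
  (the package's convergence clause) a MONOTONE profile `R → ∞` below any cap with
  `truncDeviationCk … (R τ) τ → 0` (step profile at precision `1/(n+1)` + monotonicity in `R`);
* `exists_carter_reach_clock` — for the rest-frame clock chart `Ψ₁ = Φ ∘ A` on
  `boostedKerrBackground 1 0 M a` (subextremal): from (Ofut) at the points `A y`, the convergence
  clause and the package/time-raising data of `exists_carter_hraise`, ONE monotone profile
  `R → ∞` carrying both the convergence `truncDeviationCk … (R τ) τ → 0` and, for every `δ > 0`, the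
  certified reach: after a model time, every `y` with `t*(y) ≤ τ₁`, `r₊ + δ ≤ r(y) ≤ R(t*(y))` lies in
  `J⁻(Ψ₁({t* = τ₁, r ≤ R τ₁}))` — the hypothesis `hstat` of `exterior_subset_certified_union_causalPast₃`
  together with its profile.
[Carter 1968; O'Neill 1983, Ch. 14; folklore]
-/

noncomputable section

set_option linter.dupNamespace false

open Set Filter Topology Function TopologicalSpace Literature.Geometry.Lorentzian
open Summit.FinalStateConjecture.FinalStateConjecture.Theorems.SublinearIsFree.Rechart
open scoped Manifold ContDiff ENNReal

namespace Summit.FinalStateConjecture.FinalStateConjecture.Theorems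

/-- **A monotone convergence profile.** If `f τ R → 0` as `τ → ∞` for every fixed `R`, and `f τ ·` is
monotone, there is a monotone profile `R → ∞` below any cap `→ ∞` with `f τ (R τ) → 0`. [folklore] -/
theorem exists_monotone_convergence_profile {f : ℝ → ℝ → ℝ≥0∞}
    (h : ∀ R : ℝ, Tendsto (fun τ ↦ f τ R) atTop (𝓝 0)) (hmono : ∀ τ, Monotone (f τ))
    (cap : ℝ → ℝ) (hcap : Monotone cap) (hcaptop : Tendsto cap atTop atTop) :
    ∃ R : ℝ → ℝ, Monotone R ∧ Tendsto R atTop atTop ∧ (∀ t, R t ≤ max (cap t) 0) ∧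
      Tendsto (fun τ ↦ f τ (R τ)) atTop (𝓝 0) := by
  set Q : ℕ → ℝ → Prop := fun n τ ↦ f τ n ≤ ENNReal.ofReal (1 / ((n : ℝ) + 1)) with hQ
  have hstage : ∀ n : ℕ, ∃ T : ℝ, ∀ t, T ≤ t → Q n t := fun n ↦ by
    have hε : (0 : ℝ≥0∞) < ENNReal.ofReal (1 / ((n : ℝ) + 1)) := ENNReal.ofReal_pos.2 (by positivity)
    obtain ⟨T, hT⟩ := eventually_atTop.1 (ENNReal.tendsto_nhds_zero.1 (h n) _ hε)
    exact ⟨T, hT⟩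
  obtain ⟨Rn, hRm, hRtop, T, hT⟩ := exists_step_profile hstage
  -- cap it
  set R : ℝ → ℝ := fun t ↦ min (Rn t : ℝ) (max (cap t) 0) with hR
  have hRle : ∀ t, R t ≤ Rn t := fun t ↦ min_le_left _ _
  refine ⟨R, fun t t' htt' ↦ min_le_min (by exact_mod_cast hRm htt') (max_le_max (hcap htt') le_rfl),
    ?_, fun t ↦ min_le_right _ _, ?_⟩
  · refine tendsto_atTop_atTop.mpr fun b ↦ ?_
    obtain ⟨t₁, ht₁⟩ := eventually_atTop.1 (tendsto_atTop.1 hRtop b)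
    obtain ⟨t₂, ht₂⟩ := eventually_atTop.1 (tendsto_atTop.1 hcaptop b)
    exact ⟨max t₁ t₂, fun t ht ↦ le_min (ht₁ t ((le_max_left _ _).trans ht))
      ((ht₂ t ((le_max_right _ _).trans ht)).trans (le_max_left _ _))⟩
  · -- `f τ (R τ) ≤ f τ (Rn τ) ≤ 1/(Rn τ + 1) → 0`
    have hbound : ∀ᶠ τ in atTop, f τ (R τ) ≤ ENNReal.ofReal (1 / ((Rn τ : ℝ) + 1)) := by
      filter_upwards [eventually_ge_atTop T] with τ hτ
      exact (hmono τ (hRle τ)).trans (hT τ hτ)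
    have hlim : Tendsto (fun τ ↦ ENNReal.ofReal (1 / ((Rn τ : ℝ) + 1))) atTop (𝓝 0) := by
      rw [← ENNReal.ofReal_zero]
      refine ENNReal.tendsto_ofReal ?_
      have h1 : Tendsto (fun τ ↦ (Rn τ : ℝ) + 1) atTop atTop := tendsto_atTop_add_const_right _ _ hRtop
      exact tendsto_const_nhds.div_atTop h1
    exact tendsto_of_tendsto_of_tendsto_of_le_of_le' tendsto_const_nhds hlim
      (Eventually.of_forall fun τ ↦ zero_le) hbound

section Clock

variable {𝓢 : Spacetime 4} {M a : ℝ} (hsub : Kerr.IsSubextremal M a)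
  (U : Opens E4) (Φ : U → 𝓢.carrier) (hΦ : ContMDiff 𝓘(ℝ, E4) (𝓡 4) ∞ Φ)
  {A : E4 → E4} (hA : ContDiff ℝ ∞ A) (hAU : ∀ y ∈ (boostedKerrBackground 1 0 M a).domain, A y ∈ U)
  (Qp : U → Prop)
  (hOfut : ∀ x : U, Qp x → ∀ w : E4, 0 < w 0 →
    𝓢.metric.val (Φ x) (mfderiv 𝓘(ℝ, E4) (𝓡 4) Φ x w) (mfderiv 𝓘(ℝ, E4) (𝓡 4) Φ x w) < 0 →
      𝓢.timeOrientation.IsFutureDirected (mfderiv 𝓘(ℝ, E4) (𝓡 4) Φ x w))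
  (hQA : ∀ (y : E4) (hy : y ∈ (boostedKerrBackground 1 0 M a).domain), Qp ⟨A y, hAU y hy⟩)
  (hconvR : ∀ R : ℝ, Tendsto (fun τ ↦ 𝓢.truncDeviationCk (boostedKerrBackground 1 0 M a)
    (fun y : (boostedKerrBackground 1 0 M a).domain ↦ Φ ⟨A y.1, hAU y.1 y.2⟩) 2 R τ) atTop (𝓝 0))
  -- clock-chart package data of the hole (normalised frame, clock, honest-chart agreement)
  (Λ : ℝ → lorentzGroup) (ξ : ℝ → E3) (T₀ : ℝ → ℝ)
  (hΛ : ContDiff ℝ ∞ (fun t ↦ ((Λ t : E4 ≃L[ℝ] E4) : E4 →L[ℝ] E4)))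
  (hξ : ContDiff ℝ ∞ ξ) (hT₀ : ContDiff ℝ ∞ T₀)
  (hclock : ∀ τ, deriv T₀ τ = frameVel (Λ (T₀ τ)) 0) (hpos : ∀ t, 0 < frameVel (Λ t) 0)
  (hdec : Tendsto (fun t ↦ deriv (fun s ↦ frameTilt (Λ s)) t) atTop (𝓝 0))
  (htop : Tendsto T₀ atTop atTop)
  (hhon : ∀ K : ℝ, ∃ τK : ℝ, ∀ y : E4, τK ≤ y 0 → ‖E4.spatial y‖ ≤ K →
    A =ᶠ[𝓝 y] honestChart Λ ξ T₀)
  (cap : ℝ → ℝ) (hcap : Monotone cap) (hcaptop : Tendsto cap atTop atTop)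

include hsub hΦ hA hOfut hQA hconvR hΛ hξ hT₀ hclock hpos hdec htop hhon hcap hcaptop in
/-- **Certified Carter reach of the clock chart from the package data.** See the module docstring.
[cite: Carter1968] -/
theorem exists_carter_reach_clock :
    ∃ R : ℝ → ℝ, Monotone R ∧ Tendsto R atTop atTop ∧ (∀ t, R t ≤ max (cap t) 0) ∧
      Tendsto (fun τ ↦ 𝓢.truncDeviationCk (boostedKerrBackground 1 0 M a)
        (fun y : (boostedKerrBackground 1 0 M a).domain ↦ Φ ⟨A y.1, hAU y.1 y.2⟩) 2 (R τ) τ) atTop (𝓝 0) ∧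
      ∀ δ : ℝ, 0 < δ → ∃ S : ℝ, ∀ (y : (boostedKerrBackground 1 0 M a).domain) (τ₁ : ℝ),
        S ≤ (boostedKerrBackground 1 0 M a).time y.1 →
        (boostedKerrBackground 1 0 M a).time y.1 ≤ τ₁ →
        Kerr.rPlus M a + δ ≤ (boostedKerrBackground 1 0 M a).radius y.1 →
        (boostedKerrBackground 1 0 M a).radius y.1 ≤ R ((boostedKerrBackground 1 0 M a).time y.1) →
        Φ ⟨A y.1, hAU y.1 y.2⟩ ∈ 𝓢.metric.causalPast 𝓢.timeOrientation
          ((fun y : (boostedKerrBackground 1 0 M a).domain ↦ Φ ⟨A y.1, hAU y.1 y.2⟩) ''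
            (boostedKerrBackground 1 0 M a).truncTimeSlab (R τ₁) τ₁) := by
  -- the two profiles and their minimum
  obtain ⟨R₁, hR₁m, hR₁top, hR₁cap, hconv₁⟩ := exists_monotone_convergence_profile hconvR
    (fun τ R R' h ↦ 𝓢.truncDeviationCk_mono _ _ 2 h τ) cap hcap hcaptop
  obtain ⟨R₂, hR₂m, hR₂top, -, S₁, hraise₂⟩ := exists_carter_hraise Λ ξ T₀ hΛ hξ hT₀ hclock hpos hdec
    htop a hhon cap hcap hcaptop hsub
  set R : ℝ → ℝ := fun t ↦ min (R₁ t) (R₂ t - |a|) with hR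
  have hRm : Monotone R := fun t t' h ↦ min_le_min (hR₁m h) (sub_le_sub_right (hR₂m h) _)
  have hRtop : Tendsto R atTop atTop := by
    refine tendsto_atTop.2 fun b ↦ ?_
    filter_upwards [tendsto_atTop.1 hR₁top b, tendsto_atTop.1 hR₂top (b + |a|)] with t h1 h2
    exact le_min h1 (by linarith)
  have hR₁le : ∀ t, R t ≤ R₁ t := fun t ↦ min_le_left _ _
  have hR₂le : ∀ t, R t ≤ R₂ t - |a| := fun t ↦ min_le_right _ _
  have hconv : Tendsto (fun τ ↦ 𝓢.truncDeviationCk (boostedKerrBackground 1 0 M a)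
      (fun y : (boostedKerrBackground 1 0 M a).domain ↦ Φ ⟨A y.1, hAU y.1 y.2⟩) 2 (R τ) τ) atTop (𝓝 0) :=
    tendsto_of_tendsto_of_tendsto_of_le_of_le' tendsto_const_nhds hconv₁
      (Eventually.of_forall fun τ ↦ zero_le)
      (Eventually.of_forall fun τ ↦ 𝓢.truncDeviationCk_mono _ _ 2 (hR₁le τ) τ)
  have hraise : ∀ y ∈ (boostedKerrBackground 1 0 M a).domain,
      S₁ ≤ (boostedKerrBackground 1 0 M a).time y →
      (boostedKerrBackground 1 0 M a).radius y ≤ R ((boostedKerrBackground 1 0 M a).time y) →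
      1 / 8 ≤ (fderiv ℝ A y (((1 : lorentzGroup) : E4 ≃L[ℝ] E4) (carterField a (poincareInv 1 0 y)))) 0 :=
    fun y hy hyS hyR ↦ hraise₂ y hy hyS (hyR.trans (hR₂le _))
  refine ⟨R, hRm, hRtop, fun t ↦ (hR₁le t).trans (hR₁cap t), hconv, fun δ hδ ↦ ?_⟩
  exact exists_carter_reach 1 0 hsub U Φ hΦ hA hAU Qp hOfut hQA R hRm hconv hraise hδ

end Clock

/-- Registered one-line form (stub `monotone_convergence_profile_rechart` of the crux item) of
`exists_monotone_convergence_profile`. [folklore] -/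
theorem monotone_convergence_profile_rechart : open Filter Topology in ∀ {f : ℝ → ℝ → ENNReal}, (∀ R : ℝ, Tendsto (fun τ ↦ f τ R) atTop (nhds 0)) → (∀ τ, Monotone (f τ)) → ∀ (cap : ℝ → ℝ), Monotone cap → Tendsto cap atTop atTop → ∃ R : ℝ → ℝ, Monotone R ∧ Tendsto R atTop atTop ∧ (∀ t, R t ≤ max (cap t) 0) ∧ Tendsto (fun τ ↦ f τ (R τ)) atTop (nhds 0) :=
  fun h hmono cap hcap hcaptop ↦ exists_monotone_convergence_profile h hmono cap hcap hcaptop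

end Summit.FinalStateConjecture.FinalStateConjecture.Theorems
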